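import Summits.KontsevichZagierPeriods.KontsevichZagierPeriods.Theses.HurwitzMicroSectors
import Summits.KontsevichZagierPeriods.KontsevichZagierPeriods.Theorems.HurwitzMicroSectorsNormalFormPrinciplePiBoxTransfer

/-! TTRL-lite variant V2283 of stmt-KontsevichZagierPeriods-3869

Variant V2283 = `stub_boxRigidity` (the leaf `BoxRigidity` of `NormalFormPrinciple`: two representations
on open unit boxes with integrands of KZ's rational shape and equal values are KZ-equivalent) with BOTH
dimensions frozen, `fix m := 5; fix m' := 2`. Verdict of the attempt seat: **open** — this file is the
exact-strength certificate, not a proof of the variant. Unlike the one-sided moves (`…Variants2200`–`2261`,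
each equivalent to the whole leaf), a TWO-sided freeze does weaken the leaf, but only down to the
two-sided BOUNDED leaf at the larger frozen dimension. For EVERY pair `(K, m₀)`:
`BoxRigidity(K, m₀) ⟺ BoxVanishing(max K m₀) ⟺ (BoxRigidity for all m, m' ≤ max K m₀)`
(`boxRigidityPair_iff_boxVanishingDim`, `boxRigidityPair_iff_boxRigidityLe`; the private helpers are
local copies of the sibling certificates' lemmas — `…Variants2238` `boxVanishingDim_left/right_of_pair`,
`boxVanishingDim_mono`, `boxRigidityLe_of_boxVanishingDim` —, kept private so that this file depends on
the two payload imports only): the zero representation on the other box is box-rational of value `0`, so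
the frozen pair makes every box-rational representation of dimension `K`, resp. `m₀`, and value `0` a
relation; padding by unit intervals (`stub_boxCombineAux.pad_le`, one Newton–Leibniz move per interval)
and subtracting on the common box (`stub_boxCombineAux.sub_same`, rule 1b) turn `BoxVanishing K` into
rigidity for all dimensions `≤ K`. Hence `V2283 ⟺ BoxVanishing 5 ⟺ BoxRigidity(m, m' ≤ 5)`
(`stub_boxRigidity_var2283_iff_boxVanishing_five`, `stub_boxRigidity_var2283_iff_le_five`), which
contains the level `2` (every vanishing `ℚ`-rational absolutely convergent `∫∫_{(0,1)²} p/q` is generated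
by the four moves: `π²`, Catalan's `G`, `Li₂` at rationals, `log·log`, `L(2,χ)` …) — open; the tree's
knowledge stops at `m, m' ≤ 1` (`boxRigidity_of_le_one`, Baker, file `…BoxRigidityDimOne`). Conversely
`KontsevichZagierPeriods → V2283` (`stub_boxRigidity_var2283_of_statement`), so a refutation of the
variant would refute the Summit, and the tree has no invariant of `KZ.relations` finer than `eval`.
The general pair statement settles every programmatic move `fix_nat:m=a; fix_nat:m'=b` of this stub at
once: it is exactly the two-sided bound `max a b`.
Source: M. Kontsevich, D. Zagier, *Periods* (2001), §1.2 Conjecture 1. Pure proof file, no definitions. -/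

-- `Summit.<Summit>.<Problem>` is the tree's mandated summit-side namespace (CONVENTIONS §2); for this
-- single-conjunct summit the two coincide, so the duplicate is deliberate.
set_option linter.dupNamespace false

noncomputable section

namespace Summit.KontsevichZagierPeriods.KontsevichZagierPeriods.Theorems

open MeasureTheory Set
open Literature.NumberTheory.Transcendental Literature.NumberTheory.Transcendental.KZ
open Summit.KontsevichZagierPeriods.KontsevichZagierPeriods.Theses.HurwitzMicroSectors
open Summit.KontsevichZagierPeriods.HurwitzMicroSectors.NormalFormPrinciple.PiBox
open Summit.KontsevichZagierPeriods.HurwitzMicroSectors.NormalFormPrinciple.PiBox.stub_boxCombineAux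
  (pad_le sub_same)

/-! ## A frozen PAIR of dimensions is `BoxVanishing` of the larger one -/

/-- `BoxVanishing` descends along padding: dimension `K` controls every `j ≤ K` (`pad_le`; the padded
representation has the same value by soundness). Local copy of `boxVanishingDim_mono` (`…Variants2238`).
[cite: KontsevichZagier2001, §1.2] -/
private theorem vanishing_mono {j K : ℕ} (h : j ≤ K)
    (hvan : ∀ (M : IntegralRep K), M.domain = {x | ∀ i, x i ∈ Set.Ioo (0:ℝ) 1} →
      M.IsRational → M.value = 0 → of M ∈ relations)
    (N : IntegralRep j) (hNd : N.domain = {x | ∀ i, x i ∈ Set.Ioo (0:ℝ) 1})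
    (hNr : N.IsRational) (hv : N.value = 0) : of N ∈ relations := by
  obtain ⟨R, hRd, hRr, hR⟩ := pad_le h N hNd hNr
  have hRv : R.value = 0 := by
    have e := relations_le_ker_eval_holds hR
    rw [AddMonoidHom.mem_ker, map_sub, eval_of, eval_of, hv, zero_sub, neg_eq_zero] at e
    exact e
  have := relations.add_mem hR (hvan R hRd hRr hRv)
  rwa [sub_add_cancel] at this

/-- `BoxVanishing K` ⇒ rigidity for all dimensions `m, m' ≤ K`: pad both representations to the
`K`-box (`pad_le`), subtract there (`sub_same`, rule 1b); the difference is ONE box-rational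
representation of dimension `K` and value `0`. Local copy of `boxRigidityLe_of_boxVanishingDim`
(`…Variants2238`). [cite: KontsevichZagier2001, §1.2 Conjecture 1] -/
private theorem rigidityLe_of_vanishing (K : ℕ)
    (hvan : ∀ (M : IntegralRep K), M.domain = {x | ∀ i, x i ∈ Set.Ioo (0:ℝ) 1} →
      M.IsRational → M.value = 0 → of M ∈ relations) :
    ∀ (m m' : ℕ) (N : IntegralRep m) (N' : IntegralRep m'), m ≤ K → m' ≤ K →
      N.domain = {x | ∀ i, x i ∈ Set.Ioo (0:ℝ) 1} → N.IsRational →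
      N'.domain = {x | ∀ i, x i ∈ Set.Ioo (0:ℝ) 1} → N'.IsRational →
      N.value = N'.value → Equivalent N N' := by
  intro m m' N N' hm hm' hNd hNr hN'd hN'r hv
  obtain ⟨R₁, h₁d, h₁r, h₁⟩ := pad_le hm N hNd hNr
  obtain ⟨R₂, h₂d, h₂r, h₂⟩ := pad_le hm' N' hN'd hN'r
  obtain ⟨M, hMd, hMr, hM⟩ := sub_same R₁ R₂ h₁d h₁r h₂d h₂r
  have hMv : M.value = 0 := by
    have e₁ := relations_le_ker_eval_holds h₁
    have e₂ := relations_le_ker_eval_holds h₂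
    have e := relations_le_ker_eval_holds hM
    rw [AddMonoidHom.mem_ker, map_sub, eval_of, eval_of, sub_eq_zero] at e₁ e₂
    rw [AddMonoidHom.mem_ker, map_sub, map_sub, eval_of, eval_of, eval_of, ← e₁, ← e₂, hv,
      sub_self, zero_sub, neg_eq_zero] at e
    exact e
  have e : of N - of N' =
      (of N - of R₁) - (of N' - of R₂) + (of R₁ - of R₂ - of M) + of M := by abel
  show of N - of N' ∈ relations
  rw [e]
  exact relations.add_mem (relations.add_mem (relations.sub_mem h₁ h₂) hM) (hvan M hMd hMr hMv)

/-- Rigidity for the pair `(K, m₀)` ⇒ `BoxVanishing K`: compare with the zero representation on the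
`m₀`-box (box-rational, value `0`, itself a relation). Local copy of `boxVanishingDim_left_of_pair`
(`…Variants2238`). [cite: KontsevichZagier2001, §1.2 Conjecture 1] -/
private theorem vanishing_left_of_pair (K m₀ : ℕ)
    (hrig : ∀ (N : IntegralRep K) (N' : IntegralRep m₀),
      N.domain = {x | ∀ i, x i ∈ Set.Ioo (0:ℝ) 1} → N.IsRational →
      N'.domain = {x | ∀ i, x i ∈ Set.Ioo (0:ℝ) 1} → N'.IsRational →
      N.value = N'.value → Equivalent N N')
    (N : IntegralRep K) (hNd : N.domain = {x | ∀ i, x i ∈ Set.Ioo (0:ℝ) 1})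
    (hNr : N.IsRational) (hv : N.value = 0) : of N ∈ relations := by
  obtain ⟨Z, hZd, hZi⟩ := exists_zeroRep (isSemialgebraic_box m₀)
  have hZ : of Z ∈ relations := of_mem_relations_of_eqOn_zero Z (by simp [hZi, EqOn])
  have hZv : Z.value = 0 := by simp [IntegralRep.value, hZi]
  have hZr : Z.IsRational := ⟨0, 1, fun x _ => by simp, fun x _ => by simp [hZi]⟩
  have h : of N - of Z ∈ relations := hrig N Z hNd hNr hZd hZr (by rw [hv, hZv])
  have := relations.add_mem h hZ
  rwa [sub_add_cancel] at this

/-- Rigidity for the pair `(K, m₀)` ⇒ `BoxVanishing m₀`, from the other side. Local copy of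
`boxVanishingDim_right_of_pair` (`…Variants2238`). [cite: KontsevichZagier2001, §1.2 Conjecture 1] -/
private theorem vanishing_right_of_pair (K m₀ : ℕ)
    (hrig : ∀ (N : IntegralRep K) (N' : IntegralRep m₀),
      N.domain = {x | ∀ i, x i ∈ Set.Ioo (0:ℝ) 1} → N.IsRational →
      N'.domain = {x | ∀ i, x i ∈ Set.Ioo (0:ℝ) 1} → N'.IsRational →
      N.value = N'.value → Equivalent N N')
    (N : IntegralRep m₀) (hNd : N.domain = {x | ∀ i, x i ∈ Set.Ioo (0:ℝ) 1})
    (hNr : N.IsRational) (hv : N.value = 0) : of N ∈ relations := by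
  obtain ⟨Z, hZd, hZi⟩ := exists_zeroRep (isSemialgebraic_box K)
  have hZ : of Z ∈ relations := of_mem_relations_of_eqOn_zero Z (by simp [hZi, EqOn])
  have hZv : Z.value = 0 := by simp [IntegralRep.value, hZi]
  have hZr : Z.IsRational := ⟨0, 1, fun x _ => by simp, fun x _ => by simp [hZi]⟩
  have h : of Z - of N ∈ relations := hrig Z N hZd hZr hNd hNr (by rw [hv, hZv])
  have := relations.sub_mem hZ h
  rwa [sub_sub_cancel] at this

/-- **`BoxRigidity(K, m₀) ⟺ BoxVanishing(max K m₀)`**: every two-sided freeze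
`fix_nat:m=K; fix_nat:m'=m₀` of `stub_boxRigidity` is exactly BoxVanishing at the larger dimension.
[cite: KontsevichZagier2001, §1.2 Conjecture 1] -/
theorem boxRigidityPair_iff_boxVanishingDim (K m₀ : ℕ) :
    (∀ (N : IntegralRep K) (N' : IntegralRep m₀),
      N.domain = {x | ∀ i, x i ∈ Set.Ioo (0:ℝ) 1} → N.IsRational →
      N'.domain = {x | ∀ i, x i ∈ Set.Ioo (0:ℝ) 1} → N'.IsRational →
      N.value = N'.value → Equivalent N N') ↔
    (∀ (M : IntegralRep (max K m₀)), M.domain = {x | ∀ i, x i ∈ Set.Ioo (0:ℝ) 1} →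
      M.IsRational → M.value = 0 → of M ∈ relations) := by
  constructor
  · intro hrig
    rcases le_total m₀ K with h | h
    · rw [max_eq_left h]
      exact vanishing_left_of_pair K m₀ hrig
    · rw [max_eq_right h]
      exact vanishing_right_of_pair K m₀ hrig
  · intro hvan N N'
    exact rigidityLe_of_vanishing (max K m₀) hvan K m₀ N N' (le_max_left K m₀)
      (le_max_right K m₀)

/-- **`BoxRigidity(K, m₀) ⟺ BoxRigidity for all m, m' ≤ max K m₀`**: a two-sided freeze of
`stub_boxRigidity` is exactly the two-sided BOUNDED leaf at the larger frozen dimension.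
[cite: KontsevichZagier2001, §1.2 Conjecture 1] -/
theorem boxRigidityPair_iff_boxRigidityLe (K m₀ : ℕ) :
    (∀ (N : IntegralRep K) (N' : IntegralRep m₀),
      N.domain = {x | ∀ i, x i ∈ Set.Ioo (0:ℝ) 1} → N.IsRational →
      N'.domain = {x | ∀ i, x i ∈ Set.Ioo (0:ℝ) 1} → N'.IsRational →
      N.value = N'.value → Equivalent N N') ↔
    (∀ (m m' : ℕ) (N : IntegralRep m) (N' : IntegralRep m'), m ≤ max K m₀ → m' ≤ max K m₀ →
      N.domain = {x | ∀ i, x i ∈ Set.Ioo (0:ℝ) 1} → N.IsRational →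
      N'.domain = {x | ∀ i, x i ∈ Set.Ioo (0:ℝ) 1} → N'.IsRational →
      N.value = N'.value → Equivalent N N') := by
  rw [boxRigidityPair_iff_boxVanishingDim]
  exact ⟨rigidityLe_of_vanishing (max K m₀),
    fun h => vanishing_left_of_pair (max K m₀) (max K m₀)
      fun N N' => h _ _ N N' le_rfl le_rfl⟩

/-! ## The variant V2283 itself -/

/-- **V2283 ⟺ BoxVanishing(5)**: a box-rational representation on the `5`-box of value `0` is a
relation. [cite: KontsevichZagier2001, §1.2 Conjecture 1] -/
theorem stub_boxRigidity_var2283_iff_boxVanishing_five :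
    (∀ (N : IntegralRep 5) (N' : IntegralRep 2), N.domain = {x | ∀ i, x i ∈ Set.Ioo (0:ℝ) 1} → N.IsRational → N'.domain = {x | ∀ i, x i ∈ Set.Ioo (0:ℝ) 1} → N'.IsRational → N.value = N'.value → Equivalent N N') ↔
    (∀ (N : IntegralRep 5), N.domain = {x | ∀ i, x i ∈ Set.Ioo (0:ℝ) 1} →
      N.IsRational → N.value = 0 → of N ∈ relations) :=
  boxRigidityPair_iff_boxVanishingDim 5 2

/-- **V2283 ⟺ the two-sided bounded leaf `BoxRigidity(m, m' ≤ 5)`** — strictly between the tree's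
theorem `boxRigidity_of_le_one` (`m, m' ≤ 1`, Baker) and the full leaf; the level `2` it contains is
open. [cite: KontsevichZagier2001, §1.2 Conjecture 1] -/
theorem stub_boxRigidity_var2283_iff_le_five :
    (∀ (N : IntegralRep 5) (N' : IntegralRep 2), N.domain = {x | ∀ i, x i ∈ Set.Ioo (0:ℝ) 1} → N.IsRational → N'.domain = {x | ∀ i, x i ∈ Set.Ioo (0:ℝ) 1} → N'.IsRational → N.value = N'.value → Equivalent N N') ↔
    (∀ (m m' : ℕ) (N : IntegralRep m) (N' : IntegralRep m'), m ≤ 5 → m' ≤ 5 →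
      N.domain = {x | ∀ i, x i ∈ Set.Ioo (0:ℝ) 1} → N.IsRational →
      N'.domain = {x | ∀ i, x i ∈ Set.Ioo (0:ℝ) 1} → N'.IsRational →
      N.value = N'.value → Equivalent N N') :=
  boxRigidityPair_iff_boxRigidityLe 5 2

/-- **V2283 ⇒ BoxVanishing in every dimension `≤ 5`** (monotonicity along padding); the
first open level is `2`: every `ℚ`-rational absolutely convergent `∫∫_{(0,1)²} p/q` of value `0` is a
relation (dilogarithm / Catalan-type relations). [cite: KontsevichZagier2001, §1.2 Conjecture 1] -/
theorem boxVanishing_le_five_of_stub_boxRigidity_var2283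
    (h : ∀ (N : IntegralRep 5) (N' : IntegralRep 2), N.domain = {x | ∀ i, x i ∈ Set.Ioo (0:ℝ) 1} → N.IsRational → N'.domain = {x | ∀ i, x i ∈ Set.Ioo (0:ℝ) 1} → N'.IsRational → N.value = N'.value → Equivalent N N')
    {j : ℕ} (hj : j ≤ 5) (N : IntegralRep j) (hNd : N.domain = {x | ∀ i, x i ∈ Set.Ioo (0:ℝ) 1})
    (hNr : N.IsRational) (hv : N.value = 0) : of N ∈ relations :=
  vanishing_mono hj (stub_boxRigidity_var2283_iff_boxVanishing_five.1 h) N hNd hNr hv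

/-- **The parent leaf ⇒ V2283** (specialisation). [cite: KontsevichZagier2001, §1.2 Conjecture 1] -/
theorem stub_boxRigidity_var2283_of_parent
    (h : ∀ (m m' : ℕ) (N : IntegralRep m) (N' : IntegralRep m'), N.domain = {x | ∀ i, x i ∈ Set.Ioo (0:ℝ) 1} → N.IsRational → N'.domain = {x | ∀ i, x i ∈ Set.Ioo (0:ℝ) 1} → N'.IsRational → N.value = N'.value → Equivalent N N') :
    ∀ (N : IntegralRep 5) (N' : IntegralRep 2), N.domain = {x | ∀ i, x i ∈ Set.Ioo (0:ℝ) 1} → N.IsRational → N'.domain = {x | ∀ i, x i ∈ Set.Ioo (0:ℝ) 1} → N'.IsRational → N.value = N'.value → Equivalent N N' :=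
  h 5 2

/-- **`KontsevichZagierPeriods ⇒ V2283`**: the variant is a special case of Conjecture 1 for the
tree's calculus — a refutation of the variant would refute the Summit. [cite: KontsevichZagier2001, §1.2 Conjecture 1] -/
theorem stub_boxRigidity_var2283_of_statement (h : _root_.KontsevichZagierPeriods) :
    ∀ (N : IntegralRep 5) (N' : IntegralRep 2), N.domain = {x | ∀ i, x i ∈ Set.Ioo (0:ℝ) 1} → N.IsRational → N'.domain = {x | ∀ i, x i ∈ Set.Ioo (0:ℝ) 1} → N'.IsRational → N.value = N'.value → Equivalent N N' :=
  (leaves_of_statement h).1 5 2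

end Summit.KontsevichZagierPeriods.KontsevichZagierPeriods.Theorems
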